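import Summits.QuantumFields.YangMills.Theorems.BalabanUVNodesK0V23Stub3ComparabilitySuppliers
import Summits.QuantumFields.YangMills.Theorems.BalabanUVNodesK2NamedJetsRunRemAt

/-!
# CRIT-1 g31 ADD4 — located-B of idea-1 (`approximant-laplace-squeeze` ED.5 + sketch ED.4; merged `two-route-twisted-laplace`) on the K0 SIDE after the
# V23 comparability currency: the ANCHORED squeeze delivers K0⁷'s comparability core ONLY together with an ANCHOR BOUND; and the K0-side letter (TwoComp)
# and the K1-side socket rows (i)(iv) of K1⁹ stmt-QuantumFields-27364 are INCOMPARABLE hypothesis shapes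

Cell `ym-nodeO-ideate`, seat `ym-nodeO-crit-1` (CRITIC idea-1..4), refuter-ym-nodeO-crit-1-g31-0, 2026-08-30.  Crux workfile on
stmt-QuantumFields-20543 (`Cruxes/EndpointGivenBR13SepCoPH/`), companion of the sheet `CRIT-1-ADD4-idea1-g31-anchor-bound-located-B.md`.
Elementary real bookkeeping over TREE shapes BY NAME (`RunConstRemainder`, `ConstRemainder`, `ScaleAnchor`, `OneLoopDrift`,
`K0V23Stub3ComparabilitySuppliers.exists_twoComparable_of_runAbsBound`) plus VERBATIM restatements of the two idea-1 kernel shapes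
(`ParabolicModulus`, `RunModulusSqueeze` — crux files are not imported).  MODEL families below are NOT Bałaban's β.

FINDINGS (kernel-checked):
* §1 (positive, by name).  `RunConstRemainder β b s γ₀` + an anchor bound `∀ k, |b k| ≤ B` ⟹ a run-wise ABS bound `|β| ≤ B + s` ⟹ TwoComp(β; γ) on some level
  `γ ∈ ]0, γ₀]`, `γ ≤ ½` (`exists_twoComparable_of_runAbsBound`).  The drift letter of 2ᶜᴰ (`OneLoopDrift s A b`) IS an anchor bound: `|b k − s| ≤ 2A`.
  So on the END road (2ᶜᴰ + the anchored squeeze) K0⁷'s comparability core follows BY NAME — g30's located-B remark (HOME STATUS l.3178 «the squeeze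
  over-delivers TwoComp») holds MODULO an anchor bound, which 2ᶜᴰ (the row-(iv) wall letter) or a k-uniform bound of ONE depth's finite-volume one-loop
  number supplies.
* §2 (negative, `_false_without_anchorBound`).  The model `β_k(v) := k =: b_k` satisfies EVERY idea-1 shape with ZERO constants (`ConstRemainder`,
  `RunConstRemainder`, `ScaleAnchor`, `ParabolicModulus`, `RunModulusSqueeze`) and K1⁹'s WHOLE socket row-triple (i) (with `b`, `r := 0`), (iv) (with `M := 0`),
  (C) (`SurvCont`, constant), yet violates TwoComp at EVERY level `γ > 0` (a backward-built in-window run of length `⌈4/γ²⌉₊ + 1`).  The anchor bound is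
  LOAD-BEARING for the K0 side; and K1⁹'s socket rows AS TYPED (`∃ b r γ₀ M`, no bound on `b`) do NOT feed K0⁷'s comparability core (`not_twoComp_of_k1SocketRows`).
* §3 (negative, converse).  The tree's comparability model `β_k(v) := 1/(2 v_k²)` (TwoComp at every level, `twoComparable_not_runAbsBound_model`) violates
  row (i) at every level: TwoComp ⇏ row (i).  With §2: the weakest K0-side NODE O letter and the K1-side socket rows are INCOMPARABLE shapes; a producer
  serving both must deliver a run-wise ABS bound (+ the drift floor for row (iv)).

HONEST FRAMING: hypothesis shapes and two toy families; nothing of Bałaban asserted or discharged; NODE O not inhabited; K0⁷ 20541 ∕ K1⁹ 27364 ∕ K3⁸ 27366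
OPEN; counts unmoved; R4 = the CONDITIONAL finite-𝕋⁴ rung `BalabanLadder.UV` only; the Yang–Mills mass gap (Clay) is NOT proved by any of this.
-/

noncomputable section

open scoped BigOperators

namespace Summit.QuantumFields.YangMills.Cruxes.EndpointGivenBR13SepCoPH.Crit1Add4AnchorBound

open Literature.MathematicalPhysics.QuantumFieldTheory.Balaban1983to89
open Literature.MathematicalPhysics.QuantumFieldTheory.Balaban1983to89.FlowStep
open Literature.MathematicalPhysics.QuantumFieldTheory.Balaban1983to89.B12Beta (HistBox)
open Literature.MathematicalPhysics.QuantumFieldTheory.Balaban1983to89.Beta.Drift (OneLoopDrift)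
open Summit.QuantumFields.YangMills.Theorems.BalabanUVNodesK2NamedJetsRemAt (ConstRemainder ScaleAnchor)
open Summit.QuantumFields.YangMills.Theorems.BalabanUVNodesK2NamedJetsRunRemAt (RunConstRemainder SurvCont runConstRemainder_of_constRemainder)
open Summit.QuantumFields.YangMills.Theorems.K0V23Stub3ComparabilitySuppliers (exists_twoComparable_of_runAbsBound twoComparable_not_runAbsBound_model)

/-! ## §0 The letters (K0 side spelled inline in the tree; named here locally for readability only) -/

/-- **TwoComp(β; γ)** — the comparability letter of `…K0V23Stub3ComparabilitySuppliers` (spelled inline there, no `def`): along every in-window solution of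
(0.20) up to `n`, consecutive couplings are 2-comparable.  Local name for the VERBATIM inline text.  HYPOTHESIS SHAPE. [cite: Balaban1988Convergent, (2.6)–(2.8) pp.255–256] -/
def TwoComp (β : HBeta) (γ : ℝ) : Prop :=
  ∀ (n : ℕ) (gs : ℕ → ℝ), RGEqH n β gs → Step.InInterval γ n gs → ∀ m, m < n → gs m ≤ 2 * gs (m + 1) ∧ gs (m + 1) ≤ 2 * gs m

/-- **Row (iv) of K1⁹'s socket, run-wise** (VERBATIM shape of the second conjunct under `∃ b r γ₀ M` in `Theses.BalabanUVNodes.StabilityBRunRowsAtRecordR13SepCoPHV`,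
= `(hrowsR :` of the K1 face of record #11576): window sums of `β` along in-window runs bounded below by `−M`.  HYPOTHESIS SHAPE. [cite: Balaban1987RG1, Thm 2 p.259] -/
def RunDriftFloor (β : HBeta) (M γ₀ : ℝ) : Prop :=
  ∀ (n : ℕ) (gs : ℕ → ℝ), RGEqH n β gs → Step.InInterval γ₀ n gs → ∀ k, k ≤ n → -M ≤ ∑ j ∈ Finset.Ico k n, β j (prefixOf gs j)

/-- VERBATIM restatement of the approximant kernel's `ParabolicModulus` (`Cruxes/EndpointGivenBR13SepCoPH/ApproximantLaplaceSketch.lean` :319–:321). HYPOTHESIS SHAPE. [folklore] -/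
def ParabolicModulus (β : HBeta) (b : ℕ → ℝ) (C τ : ℕ → ℝ) (γbar : ℝ) : Prop :=
  ∀ (r k : ℕ) (v : Fin (k + 1) → ℝ), v ∈ HistBox γbar k → |β k v - b k| ≤ τ r + C r * ‖v‖ ^ 2

/-- VERBATIM restatement of g30's common shape `RunModulusSqueeze` (`Cruxes/EndpointGivenBR13SepCoPH/Crit1Add3SameLeverSketch.lean` :81–:85). HYPOTHESIS SHAPE. [folklore] -/
def RunModulusSqueeze (β : HBeta) (b : ℕ → ℝ) (ω C : ℕ → ℝ) (γbar : ℝ) : Prop :=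
  ∀ (N : ℕ) (γ : ℝ), 0 < γ → γ ≤ γbar →
    ∀ (n : ℕ) (gs : ℕ → ℝ), RGEqH n β gs → Step.InInterval γ n gs →
      ∀ k, k ≤ n → |β k (prefixOf gs k) - b k| ≤ ω N + C N * γ ^ 2

/-! ## §1 Positive, by name: anchored run-wise remainder + ANCHOR BOUND ⟹ run-wise ABS bound ⟹ TwoComp; the drift letter is an anchor bound -/

section Positive
variable {β : HBeta} {b : ℕ → ℝ}

/-- Anchored remainder at cap `s` on level `γ₀` + `|b k| ≤ B` ⟹ `|β| ≤ B + s` along in-window runs of level `γ₀` (triangle inequality). [folklore] -/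
theorem runAbsBound_of_runConstRemainder_of_anchorBound {s γ₀ B : ℝ} (hrem : RunConstRemainder β b s γ₀) (hB : ∀ k, |b k| ≤ B) :
    ∀ (n : ℕ) (gs : ℕ → ℝ), RGEqH n β gs → Step.InInterval γ₀ n gs → ∀ k, k ≤ n → |β k (prefixOf gs k)| ≤ B + s := by
  intro n gs hrg hI k hk
  have h1 := hrem n gs hrg hI k hk
  have h2 := hB k
  calc |β k (prefixOf gs k)| = |(β k (prefixOf gs k) - b k) + b k| := by ring_nf
    _ ≤ |β k (prefixOf gs k) - b k| + |b k| := abs_add_le _ _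
    _ ≤ s + B := add_le_add h1 h2
    _ = B + s := add_comm _ _

/-- **★ ANCHORED REMAINDER + ANCHOR BOUND ⟹ K0⁷'s COMPARABILITY LETTER ON A SMALLER LEVEL** (BY NAME through `exists_twoComparable_of_runAbsBound`). [folklore] -/
theorem exists_twoComp_of_runConstRemainder_of_anchorBound {s γ₀ B : ℝ} (hγ₀ : 0 < γ₀)
    (hrem : RunConstRemainder β b s γ₀) (hB : ∀ k, |b k| ≤ B) :
    ∃ γ : ℝ, 0 < γ ∧ γ ≤ γ₀ ∧ γ ≤ 1 / 2 ∧ TwoComp β γ :=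
  exists_twoComparable_of_runAbsBound hγ₀ (runAbsBound_of_runConstRemainder_of_anchorBound hrem hB)

/-- **THE DRIFT LETTER IS AN ANCHOR BOUND**: `OneLoopDrift s A b` (2ᶜᴰ's third conjunct: `|Σ_{j<k} b_j − s·k| ≤ A`) gives `|b_k − s| ≤ 2A` for every `k`. [folklore] -/
theorem abs_sub_le_of_oneLoopDrift {s A : ℝ} (h : OneLoopDrift s A b) (k : ℕ) : |b k - s| ≤ 2 * A := by
  have h1 := h (k + 1)
  have h2 := h k
  rw [Finset.sum_range_succ] at h1
  push_cast at h1
  rw [abs_le] at h1 h2 ⊢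
  constructor <;> linarith [h1.1, h1.2, h2.1, h2.2]

/-- … hence `|b_k| ≤ |s| + 2A`. [folklore] -/
theorem anchorBound_of_oneLoopDrift {s A : ℝ} (h : OneLoopDrift s A b) (k : ℕ) : |b k| ≤ |s| + 2 * A := by
  have h1 := abs_sub_le_of_oneLoopDrift h k
  calc |b k| = |(b k - s) + s| := by ring_nf
    _ ≤ |b k - s| + |s| := abs_add_le _ _
    _ ≤ 2 * A + |s| := by linarith
    _ = |s| + 2 * A := add_comm _ _

/-- **★ ON THE END ROAD** (2ᶜᴰ's drift letter + the anchored run-wise remainder at ANY cap): K0⁷'s comparability letter on a smaller level, BY NAME. [folklore] -/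
theorem exists_twoComp_of_runConstRemainder_of_oneLoopDrift {s A r γ₀ : ℝ} (hγ₀ : 0 < γ₀)
    (hrem : RunConstRemainder β b r γ₀) (hdrift : OneLoopDrift s A b) :
    ∃ γ : ℝ, 0 < γ ∧ γ ≤ γ₀ ∧ γ ≤ 1 / 2 ∧ TwoComp β γ :=
  exists_twoComp_of_runConstRemainder_of_anchorBound hγ₀ hrem (anchorBound_of_oneLoopDrift hdrift)

/-- The same from the BOX-wise remainder `ConstRemainder` (idea-1's `constRemainder_bInf` output) — box ⟹ runs by name. [folklore] -/
theorem exists_twoComp_of_constRemainder_of_anchorBound {s γ₀ B : ℝ} (hγ₀ : 0 < γ₀)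
    (hrem : ConstRemainder β b s γ₀) (hB : ∀ k, |b k| ≤ B) :
    ∃ γ : ℝ, 0 < γ ∧ γ ≤ γ₀ ∧ γ ≤ 1 / 2 ∧ TwoComp β γ :=
  exists_twoComp_of_runConstRemainder_of_anchorBound hγ₀ (runConstRemainder_of_constRemainder hrem) hB

end Positive

/-! ## §2 Negative: WITHOUT an anchor bound every idea-1 shape (zero constants) + rows (i)(iv) hold on a model that violates TwoComp at every level -/

section Model

/-- MODEL history family (NOT Bałaban's β): `β_k(v) := k`, history-blind, unbounded in the scale index. [folklore] -/
def βlin : HBeta := fun k _ => (k : ℝ)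

/-- Its anchor sequence `b_k := k`. [folklore] -/
def blin : ℕ → ℝ := fun k => (k : ℝ)

@[simp] theorem βlin_apply (k : ℕ) (v : Fin (k + 1) → ℝ) : βlin k v = k := rfl
@[simp] theorem blin_apply (k : ℕ) : blin k = k := rfl

/-- The model meets the BOX remainder at cap `0` on every box. [folklore] -/
theorem model_constRemainder (γ₀ : ℝ) : ConstRemainder βlin blin 0 γ₀ := by
  intro k p _; simp

/-- The model meets the RUN remainder = K1⁹'s row (i) shape at cap `0` on every level. [folklore] -/
theorem model_runConstRemainder (γ₀ : ℝ) : RunConstRemainder βlin blin 0 γ₀ := by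
  intro n gs _ _ k _; simp

/-- The model meets the per-scale anchor. [folklore] -/
theorem model_scaleAnchor : ScaleAnchor βlin blin := by
  intro k δ hδ
  exact ⟨1, one_pos, fun p _ => by simp [hδ.le]⟩

/-- The model meets the parabolic modulus with `τ = C = 0`. [folklore] -/
theorem model_parabolicModulus (γbar : ℝ) : ParabolicModulus βlin blin (fun _ => 0) (fun _ => 0) γbar := by
  intro r k v _; simp

/-- The model meets the run-modulus squeeze with `ω = C = 0`. [folklore] -/
theorem model_runModulusSqueeze (γbar : ℝ) : RunModulusSqueeze βlin blin (fun _ => 0) (fun _ => 0) γbar := by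
  intro N γ _ _ n gs _ _ k _; simp

/-- The model meets K1⁹'s row (iv) shape with `M = 0` on every level (`β ≥ 0`). [folklore] -/
theorem model_runDriftFloor (γ₀ : ℝ) : RunDriftFloor βlin 0 γ₀ := by
  intro n gs _ _ k _
  rw [neg_zero]
  exact Finset.sum_nonneg fun j _ => by simp

/-- The model meets K1⁹'s row (C) shape = `SurvCont` (BY NAME) on every level: history-blind ⇒ constant in the running variable. [folklore] -/
theorem model_survCont (γ₀ : ℝ) : SurvCont βlin γ₀ :=
  fun _ => continuousOn_const

/-- The model has NO anchor bound. [folklore] -/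
theorem model_no_anchorBound : ¬ ∃ B : ℝ, ∀ k, |blin k| ≤ B := by
  rintro ⟨B, hB⟩
  obtain ⟨k, hk⟩ := exists_nat_gt B
  have h := hB k
  rw [blin_apply, abs_of_nonneg (Nat.cast_nonneg k)] at h
  linarith

/-! ### The violating run: built BACKWARDS from `g_{m+1} = γ` with `β_j = j`: `1/g_j² = 1/γ² + T(m+1) − T(j)`, `T(j) = Σ_{i<j} i`. -/

/-- Triangular sums `T(j) = Σ_{i<j} i` (as reals). [folklore] -/
def tri (j : ℕ) : ℝ := ∑ i ∈ Finset.range j, (i : ℝ)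

theorem tri_succ (j : ℕ) : tri (j + 1) = tri j + j := by
  simp [tri, Finset.sum_range_succ]

theorem tri_mono {j k : ℕ} (h : j ≤ k) : tri j ≤ tri k :=
  Finset.sum_le_sum_of_subset_of_nonneg (Finset.range_mono h) fun i _ _ => Nat.cast_nonneg i

/-- `1/g_j²` of the run. [folklore] -/
def invSq (γ : ℝ) (m j : ℕ) : ℝ := 1 / γ ^ 2 + tri (m + 1) - tri j

/-- The run itself. [folklore] -/
def run (γ : ℝ) (m : ℕ) : ℕ → ℝ := fun j => Real.sqrt (1 / invSq γ m j)

theorem invSq_ge {γ : ℝ} {m j : ℕ} (h : j ≤ m + 1) : 1 / γ ^ 2 ≤ invSq γ m j := by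
  have := tri_mono h
  unfold invSq; linarith

theorem invSq_pos {γ : ℝ} (hγ : 0 < γ) {m j : ℕ} (h : j ≤ m + 1) : 0 < invSq γ m j :=
  lt_of_lt_of_le (by positivity) (invSq_ge h)

theorem run_sq {γ : ℝ} (hγ : 0 < γ) {m j : ℕ} (h : j ≤ m + 1) : run γ m j ^ 2 = 1 / invSq γ m j :=
  Real.sq_sqrt (le_of_lt (one_div_pos.2 (invSq_pos hγ h)))

theorem one_div_run_sq {γ : ℝ} (hγ : 0 < γ) {m j : ℕ} (h : j ≤ m + 1) : 1 / run γ m j ^ 2 = invSq γ m j := by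
  rw [run_sq hγ h, one_div_one_div]

theorem run_pos {γ : ℝ} (hγ : 0 < γ) {m j : ℕ} (h : j ≤ m + 1) : 0 < run γ m j :=
  Real.sqrt_pos.2 (one_div_pos.2 (invSq_pos hγ h))

theorem run_le {γ : ℝ} (hγ : 0 < γ) {m j : ℕ} (h : j ≤ m + 1) : run γ m j ≤ γ := by
  have h1 : 1 / invSq γ m j ≤ γ ^ 2 := (one_div_le (invSq_pos hγ h) (by positivity)).2 (invSq_ge h)
  calc run γ m j = Real.sqrt (1 / invSq γ m j) := rfl
    _ ≤ Real.sqrt (γ ^ 2) := Real.sqrt_le_sqrt h1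
    _ = γ := Real.sqrt_sq hγ.le

theorem run_last {γ : ℝ} (hγ : 0 < γ) (m : ℕ) : run γ m (m + 1) = γ := by
  have e : invSq γ m (m + 1) = 1 / γ ^ 2 := by unfold invSq; ring
  calc run γ m (m + 1) = Real.sqrt (1 / invSq γ m (m + 1)) := rfl
    _ = Real.sqrt (γ ^ 2) := by rw [e, one_div_one_div]
    _ = γ := Real.sqrt_sq hγ.le

/-- The run solves (0.20) for the model up to `m + 1`. [folklore] -/
theorem rgEqH_run {γ : ℝ} (hγ : 0 < γ) (m : ℕ) : RGEqH (m + 1) βlin (run γ m) := by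
  intro k hk
  have hk' : k + 1 ≤ m + 1 := hk
  rw [one_div_run_sq hγ hk.le, one_div_run_sq hγ hk', βlin_apply]
  simp only [invSq, tri_succ]
  ring

/-- The run stays in the window `]0, γ]` up to `m + 1`. [folklore] -/
theorem inInterval_run {γ : ℝ} (hγ : 0 < γ) (m : ℕ) : Step.InInterval γ (m + 1) (run γ m) :=
  fun _ hj => ⟨run_pos hγ hj, run_le hγ hj⟩

/-- At the last step the couplings are NOT 2-comparable once `m·γ² ≥ 4`. [folklore] -/
theorem run_not_comparable {γ : ℝ} (hγ : 0 < γ) {m : ℕ} (hm : 4 ≤ (m : ℝ) * γ ^ 2) :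
    ¬ run γ m (m + 1) ≤ 2 * run γ m m := by
  intro h
  rw [run_last hγ m] at h
  have hr : 0 < run γ m m := run_pos hγ (Nat.le_succ m)
  have hsq : run γ m m ^ 2 = 1 / (1 / γ ^ 2 + m) := by
    rw [run_sq hγ (Nat.le_succ m)]
    unfold invSq; rw [tri_succ]; ring_nf
  have hA : 0 < 1 / γ ^ 2 + (m : ℝ) := by positivity
  have h2 : γ ^ 2 ≤ 4 * run γ m m ^ 2 := by nlinarith [h, hr, hγ]
  rw [hsq] at h2
  have h3 : γ ^ 2 * (1 / γ ^ 2 + m) ≤ 4 := by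
    have := mul_le_mul_of_nonneg_right h2 hA.le
    rwa [mul_assoc, one_div_mul_cancel hA.ne', mul_one] at this
  have h4 : γ ^ 2 * (1 / γ ^ 2 + m) = 1 + (m : ℝ) * γ ^ 2 := by
    rw [mul_add, mul_one_div_cancel (pow_ne_zero 2 hγ.ne')]
    ring
  linarith

/-- **★★ THE MODEL VIOLATES TwoComp AT EVERY LEVEL** (`m := ⌈4/γ²⌉₊`). [folklore] -/
theorem model_not_twoComp (γ : ℝ) (hγ : 0 < γ) : ¬ TwoComp βlin γ := by
  intro h
  set m : ℕ := ⌈4 / γ ^ 2⌉₊ with hmdef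
  have hm : 4 ≤ (m : ℝ) * γ ^ 2 := by
    have h1 : 4 / γ ^ 2 ≤ (m : ℝ) := Nat.le_ceil _
    have := (div_le_iff₀ (by positivity : (0 : ℝ) < γ ^ 2)).1 h1
    linarith
  exact run_not_comparable hγ hm (h (m + 1) (run γ m) (rgEqH_run hγ m) (inInterval_run hγ m) m (lt_add_one m)).2

/-- **★★ `_false_without_anchorBound`**: it is NOT the case that the anchored shapes of idea-1 (here the strongest, run-wise remainder at cap `0` on EVERY
level, + the per-scale anchor) together with K1⁹'s rows (i)(iv) imply K0⁷'s comparability letter at some level. [folklore] -/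
theorem not_twoComp_of_anchoredShapes_without_anchorBound :
    ¬ ∀ (β : HBeta) (b : ℕ → ℝ), (∀ γ₀, RunConstRemainder β b 0 γ₀) → ScaleAnchor β b → (∀ γ₀, RunDriftFloor β 0 γ₀) → (∀ γ₀, SurvCont β γ₀) →
        ∃ γ : ℝ, 0 < γ ∧ TwoComp β γ := by
  intro h
  obtain ⟨γ, hγ, hC⟩ := h βlin blin model_runConstRemainder model_scaleAnchor model_runDriftFloor model_survCont
  exact model_not_twoComp γ hγ hC

/-- **★★ In particular K1⁹'s WHOLE socket row-triple (i) ∧ (iv) ∧ (C) at a level `γ₀ > 0` (VERBATIM shapes, `b r γ₀ M` existential as in the decl) does NOT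
imply K0⁷'s comparability letter at any level.** [folklore] -/
theorem not_twoComp_of_k1SocketRows :
    ¬ ∀ (β : HBeta), (∃ (b : ℕ → ℝ) (r γ₀ M : ℝ), 0 < γ₀ ∧ RunConstRemainder β b r γ₀ ∧ RunDriftFloor β M γ₀ ∧ SurvCont β γ₀) →
        ∃ γ : ℝ, 0 < γ ∧ TwoComp β γ := by
  intro h
  obtain ⟨γ, hγ, hC⟩ := h βlin ⟨blin, 0, 1, 0, one_pos, model_runConstRemainder 1, model_runDriftFloor 1, model_survCont 1⟩
  exact model_not_twoComp γ hγ hC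

end Model

/-! ## §3 Converse separation: TwoComp at every level does NOT give row (i) at any level (the tree's own comparability model) -/

section Converse

/-- The tree's comparability model `β_k(v) := 1/(2 v_k²)` (`twoComparable_not_runAbsBound_model`): TwoComp at every level. [folklore] -/
def βcov : HBeta := fun k v => 1 / (2 * v (Fin.last k) ^ 2)

theorem βcov_twoComp (γ : ℝ) : TwoComp βcov γ :=
  fun n gs hrg hI m hm => twoComparable_not_runAbsBound_model.1 γ n gs hrg hI m hm

/-- … yet row (i) fails for it at EVERY level and EVERY anchor sequence: along the length-0 runs `g_0 ∈ ]0, γ₀]`, `β_0(g_0) = 1/(2g_0²)` is unbounded. [folklore] -/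
theorem βcov_not_rowI (b : ℕ → ℝ) (r γ₀ : ℝ) (hγ₀ : 0 < γ₀) : ¬ RunConstRemainder βcov b r γ₀ := by
  intro h
  -- read the letter on the constant length-0 runs g ≡ x, x ∈ ]0, γ₀]
  have key : ∀ x : ℝ, 0 < x → x ≤ γ₀ → 1 / (2 * x ^ 2) ≤ |b 0| + |r| := by
    intro x hx hxle
    have h0 := h 0 (fun _ => x) (fun k hk => absurd hk (Nat.not_lt_zero k)) (fun _ _ => ⟨hx, hxle⟩) 0 le_rfl
    simp only [βcov, prefixOf_apply] at h0
    have hpos : 0 < 1 / (2 * x ^ 2) := by positivity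
    have := abs_le.mp (h0.trans (le_abs_self r))
    calc 1 / (2 * x ^ 2) = (1 / (2 * x ^ 2) - b 0) + b 0 := by ring
      _ ≤ |r| + |b 0| := add_le_add this.2 (le_abs_self _)
      _ = |b 0| + |r| := add_comm _ _
  -- choose x small
  set K : ℝ := |b 0| + |r| + 1 with hK
  have hK0 : 0 < K := by positivity
  set x : ℝ := min γ₀ (1 / Real.sqrt (2 * K)) with hx
  have hsq : 0 < Real.sqrt (2 * K) := Real.sqrt_pos.2 (by positivity)
  have hx0 : 0 < x := lt_min hγ₀ (by positivity)
  have hxle : x ≤ γ₀ := min_le_left _ _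
  have hxK : x ≤ 1 / Real.sqrt (2 * K) := min_le_right _ _
  have hx2 : x ^ 2 ≤ 1 / (2 * K) := by
    have h1 : x ^ 2 ≤ (1 / Real.sqrt (2 * K)) ^ 2 := pow_le_pow_left₀ hx0.le hxK 2
    rw [div_pow, one_pow, Real.sq_sqrt (by positivity)] at h1
    exact h1
  have hbig : K ≤ 1 / (2 * x ^ 2) := by
    rw [le_div_iff₀ (by positivity)]
    calc K * (2 * x ^ 2) = 2 * K * x ^ 2 := by ring
      _ ≤ 2 * K * (1 / (2 * K)) := by gcongr
      _ = 1 := by field_simp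
  have := key x hx0 hxle
  linarith

/-- **★★ INCOMPARABILITY, converse half**: TwoComp at every level does not imply K1⁹'s row (i) at any level. [folklore] -/
theorem not_rowI_of_twoComp_allLevels :
    ¬ ∀ β : HBeta, (∀ γ, TwoComp β γ) → ∃ (b : ℕ → ℝ) (r γ₀ : ℝ), 0 < γ₀ ∧ RunConstRemainder β b r γ₀ := by
  intro h
  obtain ⟨b, r, γ₀, hγ₀, hrow⟩ := h βcov βcov_twoComp
  exact βcov_not_rowI b r γ₀ hγ₀ hrow

end Converse

end Summit.QuantumFields.YangMills.Cruxes.EndpointGivenBR13SepCoPH.Crit1Add4AnchorBound
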